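import Literature.NumberTheory.Sieve.BrunTwinPrimes
import Literature.NumberTheory.LFunctions.TaoCircleMethod
import HarnessLib

/-!
# Brun's upper bound for prime pairs `p + q = m`, uniformly in the shift, and the additive
# energy of the primes in a dyadic interval

Trunk T-SIEVE (`Literature/NumberTheory/Sieve`).  Everything in this file is PROVED.

For an even number `m`, the number of representations `r(m) = #{(p, q) primes : p + q = m}` with
`p, q` in a range `[1, N]` is `≪ 𝔖(m) N (log log N)² / (log N)²` by Brun's pure sieve — the same
argument as for twin primes (`Literature/NumberTheory/Sieve/BrunTwinPrimes.lean`, Cojocaru–Murty,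
Thm 5.4.4), sifting `n (n - m)` instead of `n (n + 2)` by the odd primes `p < z` **not dividing
`m`** (two residue classes `0, m (mod p)` each).  The dependence on `m` is through the factor
`K(m) = ∏_{p ∣ m, 2 < p < z} (1 - 2/p)⁻¹ ≤ ∏_{p ∣ m, p > 2} p/(p-2)` (the singular series of the
problem, up to constants), which is `≪ (log log m)⁶` uniformly.

Summing `r(m)²` gives the **additive energy** bound
`#{(p₁,p₂,p₃,p₄) ∈ 𝒫⁴ : p₁ + p₃ = p₂ + p₄} ≪ N³ (log log N)^{8} / (log N)⁴`
for any set `𝒫` of primes in `(√N…]`… precisely for `𝒫 ⊆ {primes in [N/2, N]}` (`card ≪ N/log N`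
by Chebyshev).  This is the "standard upper bound sieve" input of the footnote to the proof of
Lemma 3.7 in Tao's paper on the logarithmically averaged Chowla conjecture (Tao 2016: "The sum
may be upper bounded using a standard upper bound sieve for the primes (e.g. the Selberg sieve) to
be `O_ε(H³ / log⁴ H)`"); the pure sieve loses powers of `log log H`, which are harmless there.

## Main statements (namespace `Literature.ShiftedPrimePairs`)

* `card_filter_range_prod_eq_two_pow`, `abs_card_filter_sub_le` — local densities for the
  conditions `p ∣ n (n + c_p)` (`p ∤ c_p`): `2^{#S}` classes modulo `∏ S`, error `≤ 2^{#S}`;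
* `pure_sieve_le` — Brun's pure sieve for these conditions (Bonferroni level `r` even);
* `pairCount_le_card_sifted` — `r_𝒫(m) ≤ #{1 ≤ n ≤ N : p ∤ n(n + c_p(m)) ∀ p ∈ T_m}` for
  `𝒫 ⊆` primes in `[z, N]`, `T_m = {2 < p < z : p ∤ m}`, `c_p(m) = p - m mod p`;
* `sifted_le_of_conditions` — the explicit bound `≤ 28227 K N ℓ²/L²` (`L = log N`, `ℓ = log L`)
  under the growth conditions of `BrunTwinPrimes.eventually_conditions`, for any `K ≥ 1`
  dominating the singular factors `(∏_{p ∈ S} (1 - 2/p))⁻¹`, `S ⊆ {odd primes dividing m}`;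
* `inv_prod_le_kBound` — `(∏_{p ∈ S} (1 - 2/p))⁻¹ ≤ kBound m = e^{36} (log (log m + 2))⁶`
  (Mertens' bound for `∑_{p ≤ w} 1/p` and `#{p ∣ m : p > w} ≤ log m / log w`);
* `card_addQuadruples_eq_sum_sq` (`= ∑_m r(m)²`), `card_addQuadruples_le_of_conditions`,
  `eventually_card_addQuadruples_le`, `exists_eventually_card_addQuadruples_le` — the additive
  energy bound for primes in `[N/2, N]`, stated for `Literature.NumberTheory.LFunctions.Tao2016.addQuadruples`
  (`TaoCircleMethod.lean`), the finset consumed by `Literature.NumberTheory.LFunctions.Tao2016.card_largeFreq_le` /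
  `Literature.NumberTheory.LFunctions.Tao2016.card_Xi_le`.

## References
* A. C. Cojocaru, M. R. Murty, *An Introduction to Sieve Methods and their Applications*, CUP
  2005, §5.4 (Thm 5.4.4) and §6.1 (Brun's pure sieve). [cite: CojocaruMurty2005]
* H. Halberstam, H.-E. Richert, *Sieve Methods*, Academic Press 1974, Thm 3.11 / Cor 2.4.1 (the
  sharper form `r(m) ≤ 8 𝔖(m) N/log² N (1 + o(1))`, not needed here).
* T. Tao, Forum Math. Pi 4 (2016) e8; arXiv:1509.05422, §3, footnote to the proof of Lemma 3.7.
  [cite: TaoFMP2016, Lemma 3.7 (footnote)]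

## Design choices
* The shift is encoded prime by prime: `p ∣ n (n + c_p)` with `c_p = p - m % p ∈ [1, p-1]` for
  `p ∤ m`, so that `p ∣ n + c_p ↔ p ∣ m - n` (`n ≤ m`); this keeps the polynomial shape `n(n+c)`
  of the twin-prime file and its periodicity/CRT lemmas, now with a `p`-dependent `c`.
* Constants are explicit but not optimised; the final energy bound is stated with `∃ C` and
  `∀ᶠ N`.
* The file imports `Literature.NumberTheory.LFunctions.TaoCircleMethod` only for the finset
  `Literature.NumberTheory.LFunctions.Tao2016.addQuadruples` (so that the energy bound is literally about the consumers' object).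
-/

open Finset Real

namespace Literature.NumberTheory.Sieve

namespace ShiftedPrimePairs

/-! ### Local densities: residues `a mod d` with `d ∣ a (a + c)` -/

/-- For a prime `p ∤ c`, the congruence `t (t + c) ≡ 0 (mod p)` has exactly the two solutions
`t ≡ 0` and `t ≡ -c`. [folklore] -/
theorem card_zmod_mul_add_eq_zero {p : ℕ} [NeZero p] (hp : p.Prime) {c : ℕ} (hc : ¬p ∣ c) :
    Fintype.card {t : ZMod p // t * (t + c) = 0} = 2 := by
  classical
  haveI := Fact.mk hp
  have hc0 : (c : ZMod p) ≠ 0 := by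
    intro h
    rw [ZMod.natCast_eq_zero_iff] at h
    exact hc h
  rw [Fintype.card_subtype]
  have hset : (Finset.univ.filter fun t : ZMod p => t * (t + c) = 0) = {0, -(c : ZMod p)} := by
    ext t
    simp only [Finset.mem_filter, Finset.mem_univ, true_and, Finset.mem_insert,
      Finset.mem_singleton, mul_eq_zero, add_eq_zero_iff_eq_neg]
  rw [hset, Finset.card_pair]
  intro h
  rw [eq_comm, neg_eq_zero] at h
  exact hc0 h

/-- **Chinese remainder count.** For a finite set `S` of primes and shifts `c_p` with `p ∤ c_p`,
and `d = ∏_{p ∈ S} p`, the number of residues `a mod d` with `p ∣ a (a + c_p)` for every `p ∈ S`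
is `2 ^ #S`. [folklore] -/
theorem card_filter_range_prod_eq_two_pow (S : Finset ℕ) (c : ℕ → ℕ)
    (hS : ∀ p ∈ S, p.Prime ∧ ¬p ∣ c p) :
    #{a ∈ range (∏ p ∈ S, p) | ∀ p ∈ S, p ∣ a * (a + c p)} = 2 ^ #S := by
  classical
  set a : ↥S → ℕ := fun i => (i : ℕ) with ha_def
  have hd : ∏ p ∈ S, p = ∏ i, a i := (Finset.prod_coe_sort S (fun p => p)).symm
  have hcop : Pairwise (Function.onFun Nat.Coprime a) := by
    intro i j hij
    have hi := hS i i.2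
    have hj := hS j j.2
    exact (Nat.coprime_primes hi.1 hj.1).mpr (fun h => hij (Subtype.ext h))
  haveI hne : ∀ i, NeZero (a i) := fun i => ⟨(hS i i.2).1.ne_zero⟩
  haveI : NeZero (∏ i, a i) := ⟨Finset.prod_ne_zero_iff.mpr fun i _ => (hne i).ne⟩
  rw [hd]
  set Q : ZMod (∏ i, a i) → Prop := fun x =>
    ∀ i, (ZMod.castHom (Finset.dvd_prod_of_mem a (Finset.mem_univ i)) (ZMod (a i)) x) *
      ((ZMod.castHom (Finset.dvd_prod_of_mem a (Finset.mem_univ i)) (ZMod (a i)) x) + (c i : ℕ))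
        = 0
    with hQ_def
  have hPQ : ∀ n : ℕ, (∀ p ∈ S, p ∣ n * (n + c p)) ↔ Q (n : ZMod (∏ i, a i)) := by
    intro n
    simp only [hQ_def, map_natCast]
    constructor
    · intro h i
      have := h i i.2
      rw [← ZMod.natCast_eq_zero_iff] at this
      push_cast at this
      exact this
    · intro h p hp
      have := h ⟨p, hp⟩
      rw [← ZMod.natCast_eq_zero_iff]
      push_cast
      exact this
  rw [BrunTwinPrimes.card_filter_range_eq_card_subtype _ Q hPQ]
  have e1 : {x : ZMod (∏ i, a i) // Q x} ≃
      {y : (∀ i, ZMod (a i)) // ∀ i, y i * (y i + (c i : ℕ)) = 0} :=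
    (ZMod.prodEquivPi a hcop).toEquiv.subtypeEquiv (fun x => by
      simp only [hQ_def, RingEquiv.toEquiv_eq_coe, EquivLike.coe_coe, ZMod.prodEquivPi_apply])
  have e2 : {y : (∀ i, ZMod (a i)) // ∀ i, y i * (y i + (c i : ℕ)) = 0} ≃
      (∀ i, {t : ZMod (a i) // t * (t + (c i : ℕ)) = 0}) :=
    Equiv.subtypePiEquivPi (α := ↥S) (β := fun i => ZMod (a i))
      (p := fun i (t : ZMod (a i)) => t * (t + (c i : ℕ)) = 0)
  rw [Fintype.card_congr (e1.trans e2), Fintype.card_pi]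
  have h2 : ∀ i : ↥S, Fintype.card {t : ZMod (a i) // t * (t + (c i : ℕ)) = 0} = 2 := fun i =>
    card_zmod_mul_add_eq_zero (hS i i.2).1 (hS i i.2).2
  simp only [h2, Finset.prod_const, Finset.card_univ, Fintype.card_coe]

/-- Periodicity: for `p ∣ d`, `p ∣ (n + d)(n + d + c) ↔ p ∣ n (n + c)`. [folklore] -/
theorem dvd_add_mul_add_iff {p d : ℕ} (h : p ∣ d) (c n : ℕ) :
    p ∣ (n + d) * (n + d + c) ↔ p ∣ n * (n + c) := by
  have : (n + d) * (n + d + c) = d * (2 * n + d + c) + n * (n + c) := by ring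
  rw [this]
  exact Nat.dvd_add_right (Dvd.dvd.mul_right h _)

/-- **Local densities**: for a finite set `S` of primes and shifts `c_p` with `p ∤ c_p`,
`#{1 ≤ n ≤ N : p ∣ n(n + c_p) ∀ p ∈ S} = N ∏_{p ∈ S} (2/p) + θ` with `|θ| ≤ 2^{#S}`.
[cite: CojocaruMurty2005, §5.4 proof of Theorem 5.4.4] -/
theorem abs_card_filter_sub_le (S : Finset ℕ) (c : ℕ → ℕ) (hS : ∀ p ∈ S, p.Prime ∧ ¬p ∣ c p)
    (N : ℕ) :
    |(#{n ∈ Icc 1 N | ∀ p ∈ S, p ∣ n * (n + c p)} : ℝ) - N * ∏ p ∈ S, (2 / (p : ℝ))| ≤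
      2 ^ #S := by
  set d := ∏ p ∈ S, p with hd_def
  have hd : 0 < d := Finset.prod_pos fun p hp => (hS p hp).1.pos
  have hper : Function.Periodic (fun n => ∀ p ∈ S, p ∣ n * (n + c p)) d := by
    intro n
    simp only [eq_iff_iff]
    refine forall₂_congr fun p hp => ?_
    exact dvd_add_mul_add_iff (Finset.dvd_prod_of_mem _ hp) (c p) n
  have hcount : Nat.count (fun n => ∀ p ∈ S, p ∣ n * (n + c p)) d = 2 ^ #S := by
    rw [Nat.count_eq_card_filter_range, hd_def, card_filter_range_prod_eq_two_pow S c hS]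
  have h := BrunTwinPrimes.abs_card_filter_Icc_sub_le hd _ hper N
  rw [hcount] at h
  have hprod : ∏ p ∈ S, (2 / (p : ℝ)) = (2 : ℝ) ^ #S / d := by
    rw [Finset.prod_div_distrib, Finset.prod_const, hd_def, Nat.cast_prod]
  rw [hprod, ← mul_div_assoc]
  push_cast at h
  exact h

/-! ### Brun's pure sieve for the conditions `p ∣ n (n + c_p)` -/

/-- **Brun's pure sieve for `n (n + c_p)`** (Cojocaru–Murty §6.1, (6.5) and Thm 6.1.2 with
`ω(p) = 2`): for a finite set `P` of primes with `p ∤ c_p`, `N ≥ 0` and even `r`,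
`#{1 ≤ n ≤ N : p ∤ n(n+c_p) ∀ p ∈ P} ≤ N (∏_{p ∈ P} (1 - 2/p) + ∑_{S ⊆ P, #S = r+1} ∏_{p ∈ S} 2/p)
  + 2^r ∑_{k ≤ r} C(#P, k)`.
[cite: CojocaruMurty2005, §6.1 (6.5) and Theorem 6.1.2] -/
theorem pure_sieve_le (P : Finset ℕ) (c : ℕ → ℕ) (hP : ∀ p ∈ P, p.Prime ∧ ¬p ∣ c p) (N : ℕ)
    {r : ℕ} (hr : Even r) :
    (#{n ∈ Icc 1 N | ∀ p ∈ P, ¬p ∣ n * (n + c p)} : ℝ) ≤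
      (N : ℝ) * (∏ p ∈ P, (1 - 2 / (p : ℝ)) + ∑ S ∈ P.powersetCard (r + 1), ∏ p ∈ S, 2 / (p : ℝ))
        + 2 ^ r * ∑ k ∈ range (r + 1), ((#P).choose k : ℝ) := by
  have step1 := BrunPureSieve.card_filter_forall_not_le_bonferroniSum (Icc 1 N) P
    (fun p n => p ∣ n * (n + c p)) hr
  have step2 : ∀ k ∈ range (r + 1), ∀ S ∈ P.powersetCard k,
      (-1 : ℝ) ^ k * (#{n ∈ Icc 1 N | ∀ p ∈ S, p ∣ n * (n + c p)} : ℝ) ≤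
        (-1 : ℝ) ^ k * ((N : ℝ) * ∏ p ∈ S, 2 / (p : ℝ)) + 2 ^ r := by
    intro k hk S hS
    have hSP : S ⊆ P := (Finset.mem_powersetCard.mp hS).1
    have hSk : #S = k := (Finset.mem_powersetCard.mp hS).2
    have habs := abs_card_filter_sub_le S c (fun p hp => hP p (hSP hp)) N
    rw [hSk, abs_le] at habs
    obtain ⟨hlo, hhi⟩ := habs
    have hkr : (2 : ℝ) ^ k ≤ 2 ^ r :=
      pow_le_pow_right₀ (by norm_num) (Nat.lt_succ_iff.mp (Finset.mem_range.mp hk))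
    rcases neg_one_pow_eq_or ℝ k with h1 | h1
    · rw [h1]; linarith
    · rw [h1]; linarith
  have step3 : ∑ k ∈ range (r + 1), (-1 : ℝ) ^ k *
      ∑ S ∈ P.powersetCard k, (#{n ∈ Icc 1 N | ∀ p ∈ S, p ∣ n * (n + c p)} : ℝ) ≤
      (N : ℝ) * ∑ k ∈ range (r + 1), (-1 : ℝ) ^ k * ∑ S ∈ P.powersetCard k, ∏ p ∈ S, 2 / (p : ℝ)
        + 2 ^ r * ∑ k ∈ range (r + 1), ((#P).choose k : ℝ) := by
    calc ∑ k ∈ range (r + 1), (-1 : ℝ) ^ k *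
          ∑ S ∈ P.powersetCard k, (#{n ∈ Icc 1 N | ∀ p ∈ S, p ∣ n * (n + c p)} : ℝ)
        = ∑ k ∈ range (r + 1), ∑ S ∈ P.powersetCard k,
            (-1 : ℝ) ^ k * (#{n ∈ Icc 1 N | ∀ p ∈ S, p ∣ n * (n + c p)} : ℝ) := by
          simp_rw [Finset.mul_sum]
      _ ≤ ∑ k ∈ range (r + 1), ∑ S ∈ P.powersetCard k,
            ((-1 : ℝ) ^ k * ((N : ℝ) * ∏ p ∈ S, 2 / (p : ℝ)) + 2 ^ r) :=
          Finset.sum_le_sum fun k hk => Finset.sum_le_sum fun S hS => step2 k hk S hS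
      _ = ∑ k ∈ range (r + 1),
            ((∑ S ∈ P.powersetCard k, (-1 : ℝ) ^ k * ((N : ℝ) * ∏ p ∈ S, 2 / (p : ℝ)))
              + ((#P).choose k : ℝ) * 2 ^ r) := by
          refine Finset.sum_congr rfl fun k _ => ?_
          rw [Finset.sum_add_distrib, Finset.sum_const, nsmul_eq_mul, Finset.card_powersetCard]
      _ = _ := by
          rw [Finset.sum_add_distrib, Finset.mul_sum, Finset.mul_sum]
          congr 1
          · refine Finset.sum_congr rfl fun k _ => ?_
            rw [Finset.mul_sum, Finset.mul_sum]
            exact Finset.sum_congr rfl fun S _ => by ring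
          · exact Finset.sum_congr rfl fun k _ => by ring
  have step4 := BrunPureSieve.bonferroniSum_le_prod_one_sub_add P (fun p => 2 / (p : ℝ))
    (fun p _ => by positivity)
    (fun p hp => by
      have h2 : (2 : ℝ) ≤ p := by exact_mod_cast (hP p hp).1.two_le
      rw [div_le_one (by linarith)]
      exact h2) hr
  have hN : (0 : ℝ) ≤ N := Nat.cast_nonneg N
  exact step1.trans (step3.trans (add_le_add (mul_le_mul_of_nonneg_left step4 hN) le_rfl))

/-! ### The shift attached to `m` at the prime `p`, and the sieving set -/

/-- The shift `c_p(m) = p - (m mod p)`: for `p ∤ m` it lies in `[1, p-1]` and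
`n + c_p(m) ≡ n - m (mod p)`. [folklore] -/
def shift (m p : ℕ) : ℕ := p - m % p

/-- For a prime `p ∤ m`, `p ∤ c_p(m)`. [folklore] -/
theorem not_dvd_shift {m p : ℕ} (hp : p.Prime) (hm : ¬p ∣ m) : ¬p ∣ shift m p := by
  rw [shift]
  have hlt : m % p < p := Nat.mod_lt _ hp.pos
  have hpos : 0 < m % p := Nat.pos_of_ne_zero fun h => hm (Nat.dvd_of_mod_eq_zero h)
  intro h
  have := Nat.le_of_dvd (by omega) h
  omega

/-- For `n ≤ m` and a prime `p`: `p ∣ n + c_p(m) ↔ p ∣ m - n`. [folklore] -/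
theorem dvd_add_shift_iff {m p n : ℕ} (hp : p.Prime) (hn : n ≤ m) :
    p ∣ n + shift m p ↔ p ∣ m - n := by
  haveI := Fact.mk hp
  have hlt : m % p ≤ p := (Nat.mod_lt _ hp.pos).le
  rw [← ZMod.natCast_eq_zero_iff, ← ZMod.natCast_eq_zero_iff, shift, Nat.cast_add,
    Nat.cast_sub hlt, Nat.cast_sub hn, ZMod.natCast_self, ZMod.natCast_mod]
  constructor
  · intro h
    have : ((m : ZMod p) - n) = -((n : ZMod p) + (0 - m)) := by ring
    rw [this, h, neg_zero]
  · intro h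
    have : ((n : ZMod p) + (0 - m)) = -((m : ZMod p) - n) := by ring
    rw [this, h, neg_zero]

/-- The sieving set `T_m(z)`: odd primes `p < z` not dividing `m`. [folklore] -/
def sievingSet (m z : ℕ) : Finset ℕ := ((Nat.primesBelow z).erase 2).filter fun p => ¬p ∣ m

/-- Elements of the sieving set are odd primes below `z` not dividing `m`, and `p ∤ c_p(m)`.
[folklore] -/
theorem mem_sievingSet {m z p : ℕ} (hp : p ∈ sievingSet m z) :
    p.Prime ∧ p ≠ 2 ∧ p < z ∧ ¬p ∣ m ∧ ¬p ∣ shift m p := by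
  rw [sievingSet, Finset.mem_filter, Finset.mem_erase, Nat.mem_primesBelow] at hp
  exact ⟨hp.1.2.2, hp.1.1, hp.1.2.1, hp.2, not_dvd_shift hp.1.2.2 hp.2⟩

/-- The sieving set is contained in the set of odd primes below `z`. [folklore] -/
theorem sievingSet_subset (m z : ℕ) : sievingSet m z ⊆ (Nat.primesBelow z).erase 2 :=
  Finset.filter_subset _ _

/-! ### From prime pairs `p + q = m` to the sifted set -/

/-- The number of representations `r_𝒫(m) = #{(p, q) ∈ 𝒫² : p + q = m}`. [folklore] -/
def pairCount (P : Finset ℕ) (m : ℕ) : ℕ := #{q ∈ P ×ˢ P | q.1 + q.2 = m}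

/-- **Prime pairs survive the sieve.** If `𝒫` consists of primes in `[z, N]`, then the number of
pairs `(p, q) ∈ 𝒫²` with `p + q = m` is at most the number of `1 ≤ n ≤ N` with
`p ∤ n (n + c_p(m))` for all `p ∈ T_m(z)` (both `n = p` and `m - n = q` are primes `≥ z`, hence
free of prime factors `< z`). [cite: CojocaruMurty2005, §5.4 proof of Theorem 5.4.4] -/
theorem pairCount_le_card_sifted (P : Finset ℕ) {z N : ℕ} (hP : ∀ p ∈ P, p.Prime ∧ z ≤ p ∧ p ≤ N)
    (m : ℕ) :
    pairCount P m ≤ #{n ∈ Icc 1 N | ∀ p ∈ sievingSet m z, ¬p ∣ n * (n + shift m p)} := by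
  unfold pairCount
  refine Finset.card_le_card_of_injOn Prod.fst (fun q hq => ?_) (fun q hq q' hq' h => ?_)
  · rw [Finset.coe_filter, Set.mem_setOf_eq, Finset.mem_product] at hq
    obtain ⟨⟨hq1, hq2⟩, hsum⟩ := hq
    obtain ⟨hp1, hz1, hN1⟩ := hP _ hq1
    obtain ⟨hp2, hz2, -⟩ := hP _ hq2
    rw [Finset.coe_filter, Set.mem_setOf_eq, Finset.mem_Icc]
    refine ⟨⟨hp1.one_lt.le, hN1⟩, fun p hp hdvd => ?_⟩
    obtain ⟨hpp, -, hpz, -, -⟩ := mem_sievingSet hp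
    have hle : q.1 ≤ m := by omega
    rcases (Nat.Prime.dvd_mul hpp).mp hdvd with h | h
    · have := (Nat.prime_dvd_prime_iff_eq hpp hp1).mp h; omega
    · rw [dvd_add_shift_iff hpp hle] at h
      have hq2' : m - q.1 = q.2 := by omega
      rw [hq2'] at h
      have := (Nat.prime_dvd_prime_iff_eq hpp hp2).mp h; omega
  · rw [Finset.coe_filter, Set.mem_setOf_eq] at hq hq'
    have h2 : q.2 = q'.2 := by omega
    exact Prod.ext h h2

/-! ### The parameter choice (as for twin primes) -/

/-- Splitting the sifting product: with `P₀` the odd primes below `z` and `D = {p ∈ P₀ : p ∣ m}`,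
`∏_{p ∈ T_m(z)} (1 - 2/p) = (∏_{p ∈ P₀} (1 - 2/p)) · (∏_{p ∈ D} (1 - 2/p))⁻¹`. [folklore] -/
theorem prod_sievingSet_eq (m z : ℕ) :
    ∏ p ∈ sievingSet m z, (1 - 2 / (p : ℝ)) =
      (∏ p ∈ (Nat.primesBelow z).erase 2, (1 - 2 / (p : ℝ))) *
        (∏ p ∈ ((Nat.primesBelow z).erase 2).filter (fun p => p ∣ m), (1 - 2 / (p : ℝ)))⁻¹ := by
  have hsplit := Finset.prod_filter_mul_prod_filter_not ((Nat.primesBelow z).erase 2)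
    (fun p => p ∣ m) (fun p => (1 - 2 / (p : ℝ)))
  have hpos : 0 < ∏ p ∈ ((Nat.primesBelow z).erase 2).filter (fun p => p ∣ m),
      (1 - 2 / (p : ℝ)) := by
    refine Finset.prod_pos fun p hp => ?_
    have hp' := BrunTwinPrimes.prime_of_mem_erase_two (Finset.mem_filter.mp hp).1
    have h3 : (3 : ℝ) ≤ p := by
      have := hp'.1.two_le
      have h2 : p ≠ 2 := hp'.2
      exact_mod_cast (by omega : 3 ≤ p)
    rw [sub_pos, div_lt_one (by linarith)]
    linarith
  rw [← hsplit, sievingSet]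
  field_simp

/-- **Explicit sifted-set bound, uniformly in the shift.**  With `L = log N`, `ℓ = log L ≥ 1`, the
growth conditions of `BrunTwinPrimes.twin_count_le_of_conditions`, `z = ⌈exp(L/(84 ℓ))⌉`, and any
`K ≥ 1` dominating `(∏_{p ∈ S} (1 - 2/p))⁻¹` for every set `S` of odd primes dividing `m`:
`z + #{1 ≤ n ≤ N : p ∤ n (n + c_p(m)) ∀ p ∈ T_m(z)} ≤ 28227 K N ℓ² / L²`.
(Cojocaru–Murty Thm 5.4.4, proof, with the sieving set thinned to the primes not dividing `m`.)
[cite: CojocaruMurty2005, Theorem 5.4.4 (proof)] -/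
theorem sifted_le_of_conditions (N m : ℕ) {L ℓ K : ℝ} (hL : L = Real.log N) (hℓ : ℓ = Real.log L)
    (h1 : 1 ≤ ℓ) (hR : Real.exp (59 * ℓ + L / 2) ≤ N / L ^ 2)
    (hz1 : Real.exp (L / (84 * ℓ)) + 1 ≤ N / L ^ 2) (hz3 : 3 ≤ Real.exp (L / (84 * ℓ)))
    (hK1 : 1 ≤ K)
    (hK : ∀ S : Finset ℕ, (∀ p ∈ S, p.Prime ∧ p ≠ 2 ∧ p ∣ m) →
      (∏ p ∈ S, (1 - 2 / (p : ℝ)))⁻¹ ≤ K) :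
    (⌈Real.exp (L / (84 * ℓ))⌉₊ : ℝ) +
      #{n ∈ Icc 1 N | ∀ p ∈ sievingSet m ⌈Real.exp (L / (84 * ℓ))⌉₊, ¬p ∣ n * (n + shift m p)}
        ≤ 28227 * K * N * ℓ ^ 2 / L ^ 2 := by
  -- basic positivity (verbatim from the twin-prime case)
  have hL0 : 0 ≤ L := by rw [hL]; exact Real.log_natCast_nonneg N
  have hL1 : Real.exp 1 ≤ L := by
    have hLpos : 0 < L := by
      rcases hL0.lt_or_eq with h | h
      · exact h
      · exfalso; rw [hℓ, ← h, Real.log_zero] at h1; linarith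
    have := Real.exp_le_exp.mpr (hℓ ▸ h1 : 1 ≤ Real.log L)
    rwa [Real.exp_log hLpos] at this
  have hLgt : 2 < L := lt_of_lt_of_le (by have := Real.exp_one_gt_d9; linarith) hL1
  have hLpos : 0 < L := by linarith
  have hℓpos : 0 < ℓ := by linarith
  have hN0 : (0 : ℝ) < N := by
    have hL2 : 0 < L ^ 2 := by positivity
    have h := lt_of_lt_of_le (by positivity : (0 : ℝ) < Real.exp (L / (84 * ℓ)) + 1) hz1
    by_contra hcon
    push Not at hcon
    have : (N : ℝ) / L ^ 2 ≤ 0 := div_nonpos_of_nonpos_of_nonneg hcon hL2.le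
    linarith
  have hNL : (N : ℝ) / L ^ 2 ≤ N := by
    calc (N : ℝ) / L ^ 2 ≤ N / 1 := div_le_div_of_nonneg_left hN0.le one_pos (by nlinarith)
      _ = N := div_one _
  have hNL' : (N : ℝ) / L ^ 2 ≤ N * ℓ ^ 2 / L ^ 2 := by
    rw [mul_div_right_comm]
    exact le_mul_of_one_le_right (by positivity) (by nlinarith)
  -- the parameters
  set y : ℝ := Real.exp (L / (84 * ℓ)) with hy
  set z : ℕ := ⌈y⌉₊ with hz
  set P₀ : Finset ℕ := (Nat.primesBelow z).erase 2 with hP₀def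
  set T : Finset ℕ := sievingSet m z with hTdef
  set r : ℕ := 2 * (⌈5 * ℓ⌉₊ + 15) with hr
  have hy0 : 0 < y := Real.exp_pos _
  have hy1 : 1 ≤ y := by linarith
  have hyz : y ≤ z := Nat.le_ceil y
  have hzy : (z : ℝ) ≤ y + 1 := (Nat.ceil_lt_add_one hy0.le).le
  have hz3 : 3 ≤ z := by
    have : (3 : ℝ) ≤ z := hz3.trans hyz
    exact_mod_cast this
  have hz0 : (0 : ℝ) < z := by exact_mod_cast (show 0 < z by omega)
  have hzN : z ≤ N := by
    have : (z : ℝ) ≤ N := hzy.trans (hz1.trans hNL)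
    exact_mod_cast this
  have hlogz : L / (84 * ℓ) ≤ Real.log z := by
    have : Real.log y = L / (84 * ℓ) := Real.log_exp _
    rw [← this]
    exact Real.log_le_log hy0 hyz
  have hlogz0 : 0 < Real.log z := lt_of_lt_of_le (by positivity) hlogz
  have hloglogz : Real.log (Real.log z) ≤ ℓ := by
    rw [hℓ]
    refine Real.log_le_log hlogz0 ?_
    rw [hL]
    exact Real.log_le_log hz0 (by exact_mod_cast hzN)
  have hTP₀ : T ⊆ P₀ := sievingSet_subset m z
  have hT : ∀ p ∈ T, p.Prime ∧ ¬p ∣ shift m p := fun p hp =>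
    ⟨(mem_sievingSet hp).1, (mem_sievingSet hp).2.2.2.2⟩
  have hr_even : Even r := even_two_mul _
  have hr_ge : 10 * ℓ + 30 ≤ r := by
    have : (5 * ℓ : ℝ) ≤ ⌈5 * ℓ⌉₊ := Nat.le_ceil _
    rw [hr]; push_cast; linarith
  have hr_le : (r : ℝ) ≤ 10 * ℓ + 32 := by
    have : (⌈5 * ℓ⌉₊ : ℝ) < 5 * ℓ + 1 := Nat.ceil_lt_add_one (by positivity)
    rw [hr]; push_cast; linarith
  -- Step B: the pure sieve
  have hB := pure_sieve_le T (shift m) hT N hr_even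
  -- Step C: the main term, now with the factor `K`
  have hW : ∏ p ∈ T, (1 - 2 / (p : ℝ)) ≤ K * (4 * 7056 * ℓ ^ 2 / L ^ 2) := by
    rw [hTdef, prod_sievingSet_eq m z, mul_comm]
    have hW₀ : ∏ p ∈ P₀, (1 - 2 / (p : ℝ)) ≤ 4 * 7056 * ℓ ^ 2 / L ^ 2 := by
      refine (BrunTwinPrimes.prod_one_sub_two_div_le hz3).trans ?_
      have h1' : 1 / Real.log z ≤ 84 * ℓ / L := by
        have := one_div_le_one_div_of_le (by positivity) hlogz
        rwa [one_div_div] at this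
      have h2' : (1 / Real.log z) ^ 2 ≤ (84 * ℓ / L) ^ 2 :=
        pow_le_pow_left₀ (by positivity) h1' 2
      calc 4 / Real.log z ^ 2 = 4 * (1 / Real.log z) ^ 2 := by ring
        _ ≤ 4 * (84 * ℓ / L) ^ 2 := by linarith
        _ = 4 * 7056 * ℓ ^ 2 / L ^ 2 := by ring
    have hW₀' : 0 ≤ ∏ p ∈ P₀, (1 - 2 / (p : ℝ)) := by
      refine Finset.prod_nonneg fun p hp => ?_
      have hp' := BrunTwinPrimes.prime_of_mem_erase_two hp
      have h3 : (3 : ℝ) ≤ p := by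
        have := hp'.1.two_le
        have h2 : p ≠ 2 := hp'.2
        exact_mod_cast (by omega : 3 ≤ p)
      rw [sub_nonneg, div_le_one (by linarith)]
      linarith
    have hKD : (∏ p ∈ P₀.filter (fun p => p ∣ m), (1 - 2 / (p : ℝ)))⁻¹ ≤ K :=
      hK _ fun p hp => by
        have hp' := Finset.mem_filter.mp hp
        have hp'' := BrunTwinPrimes.prime_of_mem_erase_two hp'.1
        exact ⟨hp''.1, hp''.2, hp'.2⟩
    have hKD0 : 0 ≤ (∏ p ∈ P₀.filter (fun p => p ∣ m), (1 - 2 / (p : ℝ)))⁻¹ :=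
      le_trans (by positivity) (le_trans (inv_nonneg.2 (Finset.prod_nonneg fun p hp => by
        have hp' := BrunTwinPrimes.prime_of_mem_erase_two (Finset.mem_filter.mp hp).1
        have h3 : (3 : ℝ) ≤ p := by
          have := hp'.1.two_le
          have h2 : p ≠ 2 := hp'.2
          exact_mod_cast (by omega : 3 ≤ p)
        rw [sub_nonneg, div_le_one (by linarith)]
        linarith)) le_rfl)
    exact mul_le_mul hKD hW₀ hW₀' (by linarith)
  -- Step D: the Bonferroni tail (monotone in the sieving set)
  have hE : ∑ S ∈ T.powersetCard (r + 1), ∏ p ∈ S, 2 / (p : ℝ) ≤ 1 / L ^ 2 := by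
    refine le_trans (Finset.sum_le_sum_of_subset_of_nonneg (Finset.powersetCard_mono hTP₀)
      fun S _ _ => Finset.prod_nonneg fun p _ => by positivity) ?_
    refine (BrunTwinPrimes.esymm_two_div_le (by omega : 2 ≤ z) (r + 1)).trans ?_
    have : (1 : ℝ) / L ^ 2 = Real.exp (-(2 * ℓ)) := by
      rw [Real.exp_neg, hℓ, show (2 : ℝ) * Real.log L = Real.log L + Real.log L by ring,
        Real.exp_add, Real.exp_log hLpos, one_div, sq]
    rw [this, Real.exp_le_exp]
    push_cast
    nlinarith
  -- Step E: the binomial remainder (`#T ≤ #P₀ < z`)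
  have hRem : (2 : ℝ) ^ r * ∑ k ∈ range (r + 1), ((#T).choose k : ℝ) ≤ N / L ^ 2 := by
    have hTz : #T + 1 ≤ z := le_trans (Nat.add_le_add_right (Finset.card_le_card hTP₀) 1)
      (BrunTwinPrimes.card_erase_two_add_one_le (by omega : 1 ≤ z))
    refine (BrunTwinPrimes.two_pow_mul_sum_choose_le hTz r).trans ?_
    refine le_trans ?_ hR
    have h4y : (2 * (z : ℝ)) ≤ 4 * y := by linarith
    have hlog4 : Real.log 4 < 1.4 := by
      have : Real.log 4 = Real.log 2 + Real.log 2 := by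
        rw [show (4 : ℝ) = 2 * 2 by norm_num, Real.log_mul (by norm_num) (by norm_num)]
      rw [this]; have := Real.log_two_lt_d9; linarith
    have hlog4pos : 0 < Real.log 4 := Real.log_pos (by norm_num)
    set a : ℝ := L / (84 * ℓ) with ha
    have ha0 : 0 < a := by positivity
    have hla : ℓ * a = L / 84 := by rw [ha]; field_simp
    have hale : a ≤ L / 84 := by
      rw [ha]
      exact div_le_div_of_nonneg_left hL0 (by norm_num) (by linarith)
    have h4yexp : 4 * y = Real.exp (Real.log 4 + a) := by
      rw [Real.exp_add, Real.exp_log (by norm_num : (0 : ℝ) < 4), hy]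
    calc (2 * (z : ℝ)) ^ r ≤ (4 * y) ^ r := pow_le_pow_left₀ (by positivity) h4y r
      _ = Real.exp (r * (Real.log 4 + a)) := by rw [h4yexp, ← Real.exp_nat_mul]
      _ ≤ Real.exp (59 * ℓ + L / 2) := by
          rw [Real.exp_le_exp]
          have e0 : (r : ℝ) * (Real.log 4 + a) ≤ (10 * ℓ + 32) * (Real.log 4 + a) :=
            mul_le_mul_of_nonneg_right hr_le (by positivity)
          have e1 : (10 * ℓ + 32) * (Real.log 4 + a) ≤ (10 * ℓ + 32) * (1.4 + a) :=
            mul_le_mul_of_nonneg_left (by linarith) (by positivity)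
          have e2 : (10 * ℓ + 32) * (1.4 + a) = 14 * ℓ + 44.8 + 10 * (ℓ * a) + 32 * a := by ring
          linarith
  -- Assembly
  have hsift : (#{n ∈ Icc 1 N | ∀ p ∈ T, ¬p ∣ n * (n + shift m p)} : ℝ) ≤
      N * (K * (4 * 7056 * ℓ ^ 2 / L ^ 2) + 1 / L ^ 2) + N / L ^ 2 := by
    have := mul_le_mul_of_nonneg_left (add_le_add hW hE) hN0.le
    linarith
  have hzb : (z : ℝ) ≤ N * ℓ ^ 2 / L ^ 2 := hzy.trans (hz1.trans hNL')
  have hNℓL : 0 ≤ (N : ℝ) * ℓ ^ 2 / L ^ 2 := by positivity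
  have halg : (N : ℝ) * (K * (4 * 7056 * ℓ ^ 2 / L ^ 2) + 1 / L ^ 2) + N / L ^ 2 =
      28224 * K * (N * ℓ ^ 2 / L ^ 2) + 2 * (N / L ^ 2) := by ring
  have halg2 : (28227 : ℝ) * K * N * ℓ ^ 2 / L ^ 2 = 28227 * K * (N * ℓ ^ 2 / L ^ 2) := by ring
  rw [halg2]
  have h3K : 3 * (N * ℓ ^ 2 / L ^ 2) ≤ 3 * K * (N * ℓ ^ 2 / L ^ 2) := by nlinarith
  linarith

/-! ### The singular factor `K(m)` is at most a power of `log log m` -/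

/-- For an odd prime `p`, `(1 - 2/p)⁻¹ = p/(p-2) ≤ exp(6/p)`. [folklore] -/
theorem inv_one_sub_two_div_le_exp {p : ℕ} (hp : p.Prime) (hp2 : p ≠ 2) :
    (1 - 2 / (p : ℝ))⁻¹ ≤ Real.exp (6 / p) := by
  have h3 : (3 : ℝ) ≤ p := by
    have := hp.two_le
    exact_mod_cast (by omega : 3 ≤ p)
  have hp0 : (0 : ℝ) < p := by linarith
  have hp2' : (p : ℝ) - 2 ≠ 0 := by linarith
  have e : (1 - 2 / (p : ℝ))⁻¹ = 1 + 2 / (p - 2) := by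
    rw [show (1 : ℝ) - 2 / p = (p - 2) / p by field_simp, inv_div]
    field_simp
    ring
  rw [e]
  calc 1 + 2 / ((p : ℝ) - 2) ≤ 1 + 6 / p := by
        rw [add_le_add_iff_left, div_le_div_iff₀ (by linarith) hp0]
        linarith
    _ ≤ Real.exp (6 / p) := by linarith [Real.add_one_le_exp (6 / (p : ℝ))]

/-- The singular factor over any set of odd prime divisors of `m ≠ 0`:
`(∏_{p ∈ S} (1 - 2/p))⁻¹ ≤ exp (6 ∑_{p ∣ m} 1/p)`. [folklore] -/
theorem inv_prod_le_exp_sum {m : ℕ} (hm : m ≠ 0) (S : Finset ℕ)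
    (hS : ∀ p ∈ S, p.Prime ∧ p ≠ 2 ∧ p ∣ m) :
    (∏ p ∈ S, (1 - 2 / (p : ℝ)))⁻¹ ≤ Real.exp (6 * ∑ p ∈ m.primeFactors, (1 : ℝ) / p) := by
  rw [← Finset.prod_inv_distrib]
  have hSsub : S ⊆ m.primeFactors := fun p hp =>
    Nat.mem_primeFactors.2 ⟨(hS p hp).1, (hS p hp).2.2, hm⟩
  calc ∏ p ∈ S, (1 - 2 / (p : ℝ))⁻¹ ≤ ∏ p ∈ S, Real.exp (6 / p) := by
        refine Finset.prod_le_prod (fun p hp => ?_) fun p hp =>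
          inv_one_sub_two_div_le_exp (hS p hp).1 (hS p hp).2.1
        have h3 : (3 : ℝ) ≤ p := by
          have := (hS p hp).1.two_le
          have h2 := (hS p hp).2.1
          exact_mod_cast (by omega : 3 ≤ p)
        rw [inv_nonneg, sub_nonneg, div_le_one (by linarith)]
        linarith
    _ = Real.exp (∑ p ∈ S, 6 / (p : ℝ)) := (Real.exp_sum _ _).symm
    _ ≤ Real.exp (6 * ∑ p ∈ m.primeFactors, (1 : ℝ) / p) := by
        rw [Real.exp_le_exp, Finset.mul_sum]
        have e : ∀ p : ℕ, (6 : ℝ) / p = 6 * (1 / p) := fun p => by ring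
        simp_rw [e]
        exact Finset.sum_le_sum_of_subset_of_nonneg hSsub fun p _ _ => by positivity

/-- **The prime divisors of `m` have small reciprocal sum**: for `m ≠ 0` and `w ≥ 2`,
`∑_{p ∣ m} 1/p ≤ (log log w + 4) + log m / (w log w)` — split at `w`, use Mertens' bound
`∑_{p ≤ w} 1/p ≤ log log w + 4` (`Literature.NumberTheory.LFunctions.MertensBound.sum_inv_prime_le`) for the small primes, and
note that `m` has fewer than `log m / log w` prime factors `> w`. [folklore] -/
theorem sum_primeFactors_inv_le {m : ℕ} (hm : m ≠ 0) {w : ℕ} (hw : 2 ≤ w) :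
    ∑ p ∈ m.primeFactors, (1 : ℝ) / p ≤
      Real.log (Real.log w) + 4 + Real.log m / (w * Real.log w) := by
  have hw0 : (0 : ℝ) < w := by exact_mod_cast (by omega : 0 < w)
  have hw1 : (1 : ℝ) < w := by exact_mod_cast (by omega : 1 < w)
  have hlogw : 0 < Real.log w := Real.log_pos hw1
  rw [← Finset.sum_filter_add_sum_filter_not m.primeFactors (fun p => p ≤ w)]
  refine add_le_add ?_ ?_
  · -- small primes: Mertens
    calc ∑ p ∈ m.primeFactors.filter (fun p => p ≤ w), (1 : ℝ) / p
        ≤ ∑ p ∈ Nat.primesLE w, (1 : ℝ) / p := by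
          refine Finset.sum_le_sum_of_subset_of_nonneg (fun p hp => ?_) fun p _ _ => by positivity
          rw [Finset.mem_filter, Nat.mem_primeFactors] at hp
          exact Nat.mem_primesLE.2 ⟨hp.2, hp.1.1⟩
      _ ≤ Real.log (Real.log w) + 4 := Literature.NumberTheory.LFunctions.MertensBound.sum_inv_prime_le w hw
  · -- large primes: at most `log m / log w` of them, each contributing `≤ 1/w`
    set B := m.primeFactors.filter (fun p => ¬p ≤ w) with hB
    have hcount : (#B : ℝ) * Real.log w ≤ Real.log m := by
      have hprod : (w : ℝ) ^ #B ≤ m := by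
        have h1 : w ^ #B ≤ ∏ p ∈ B, p := by
          rw [← Finset.prod_const]
          -- `∏_{B} w ≤ ∏_{B} p`
          exact Finset.prod_le_prod' fun p hp => by
            have := (Finset.mem_filter.mp hp).2
            omega
        have h2 : ∏ p ∈ B, p ∣ m :=
          (Finset.prod_dvd_prod_of_subset _ _ _ (Finset.filter_subset _ _)).trans
            (Nat.prod_primeFactors_dvd m)
        have h3 := Nat.le_of_dvd (Nat.pos_of_ne_zero hm) h2
        exact_mod_cast h1.trans h3
      have hm0 : (0 : ℝ) < m := by exact_mod_cast Nat.pos_of_ne_zero hm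
      have := Real.log_le_log (by positivity) hprod
      rwa [Real.log_pow] at this
    calc ∑ p ∈ B, (1 : ℝ) / p ≤ ∑ p ∈ B, (1 : ℝ) / w := by
          refine Finset.sum_le_sum fun p hp => ?_
          have := (Finset.mem_filter.mp hp).2
          have hpw : (w : ℝ) ≤ p := by exact_mod_cast (by omega : w ≤ p)
          exact one_div_le_one_div_of_le hw0 hpw
      _ = #B / w := by rw [Finset.sum_const, nsmul_eq_mul, mul_one_div]
      _ ≤ Real.log m / (w * Real.log w) := by
          rw [div_le_div_iff₀ hw0 (by positivity)]
          calc (#B : ℝ) * (w * Real.log w) = (#B * Real.log w) * w := by ring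
            _ ≤ Real.log m * w := mul_le_mul_of_nonneg_right hcount hw0.le

/-- The explicit bound used below: for `m ≠ 0`, `∑_{p ∣ m} 1/p ≤ log (log (log m + 2)) + 6`
(take `w = ⌊log m⌋ + 2`). [folklore] -/
theorem sum_primeFactors_inv_le' {m : ℕ} (hm : m ≠ 0) :
    ∑ p ∈ m.primeFactors, (1 : ℝ) / p ≤ Real.log (Real.log (Real.log m + 2)) + 6 := by
  set w : ℕ := ⌊Real.log m⌋₊ + 2 with hw
  have hw2 : 2 ≤ w := Nat.le_add_left 2 _
  have hm1 : (1 : ℝ) ≤ m := by exact_mod_cast Nat.pos_of_ne_zero hm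
  have hlogm : 0 ≤ Real.log m := Real.log_nonneg hm1
  have hwR : (w : ℝ) ≤ Real.log m + 2 := by
    rw [hw]; push_cast; linarith [Nat.floor_le hlogm]
  have hwR' : Real.log m < w := by
    rw [hw]; push_cast; linarith [Nat.lt_floor_add_one (Real.log m)]
  have hw0 : (0 : ℝ) < w := by exact_mod_cast (by omega : 0 < w)
  have hw2R : (2 : ℝ) ≤ w := by exact_mod_cast hw2
  have hlog2 := Real.log_two_gt_d9
  have hlogw : Real.log 2 ≤ Real.log w := Real.log_le_log (by norm_num) hw2R
  have hlogw0 : 0 < Real.log w := by linarith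
  refine (sum_primeFactors_inv_le hm hw2).trans ?_
  have h1 : Real.log (Real.log w) ≤ Real.log (Real.log (Real.log m + 2)) :=
    Real.log_le_log hlogw0 (Real.log_le_log hw0 hwR)
  have h2 : Real.log m / (w * Real.log w) ≤ 2 := by
    rw [div_le_iff₀ (by positivity)]
    nlinarith
  linarith

/-- The function `K(x) = e^{36} (log (log x + 2))⁶` dominating the singular factors `K(m)`,
`m ≤ x`. [folklore] -/
noncomputable def kBound (x : ℝ) : ℝ := Real.exp 36 * Real.log (Real.log x + 2) ^ 6

/-- `K(x)` is monotone in `x ≥ 1`. [folklore] -/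
theorem kBound_mono {x y : ℝ} (hx : 1 ≤ x) (hxy : x ≤ y) : kBound x ≤ kBound y := by
  unfold kBound
  have hlx : 0 ≤ Real.log x := Real.log_nonneg hx
  have hly : Real.log x ≤ Real.log y := Real.log_le_log (by linarith) hxy
  have h1 : Real.log (Real.log x + 2) ≤ Real.log (Real.log y + 2) :=
    Real.log_le_log (by linarith) (by linarith)
  have h0 : 0 ≤ Real.log (Real.log x + 2) := Real.log_nonneg (by linarith)
  exact mul_le_mul_of_nonneg_left (pow_le_pow_left₀ h0 h1 6) (Real.exp_pos _).le

/-- `K(x) ≥ 1` for `x ≥ 1`. [folklore] -/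
theorem one_le_kBound {x : ℝ} (hx : 1 ≤ x) : 1 ≤ kBound x := by
  unfold kBound
  have hlx : 0 ≤ Real.log x := Real.log_nonneg hx
  -- `log (log x + 2) ≥ log 2 > 1/2`, so the sixth power is `≥ 1/64`, and `e^{36} ≥ 64`
  have h1 : Real.log 2 ≤ Real.log (Real.log x + 2) := Real.log_le_log (by norm_num) (by linarith)
  have hlog2 := Real.log_two_gt_d9
  have h2 : (1 / 2 : ℝ) ^ 6 ≤ Real.log (Real.log x + 2) ^ 6 :=
    pow_le_pow_left₀ (by norm_num) (by linarith) 6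
  have h3 : (64 : ℝ) ≤ Real.exp 36 := by
    have h := pow_le_pow_left₀ (by norm_num) (by linarith [Real.exp_one_gt_d9] :
      (2 : ℝ) ≤ Real.exp 1) 36
    rw [← Real.exp_nat_mul] at h
    norm_num at h
    linarith
  have h4 : (1 / 2 : ℝ) ^ 6 = 1 / 64 := by norm_num
  rw [h4] at h2
  have h5 : 0 ≤ Real.log (Real.log x + 2) ^ 6 := by positivity
  nlinarith

/-- **The singular factor is small**: for `m ≠ 0` and every set `S` of odd primes dividing `m`,
`(∏_{p ∈ S} (1 - 2/p))⁻¹ ≤ K(m) = e^{36} (log (log m + 2))⁶`. [folklore] -/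
theorem inv_prod_le_kBound {m : ℕ} (hm : m ≠ 0) (S : Finset ℕ)
    (hS : ∀ p ∈ S, p.Prime ∧ p ≠ 2 ∧ p ∣ m) :
    (∏ p ∈ S, (1 - 2 / (p : ℝ)))⁻¹ ≤ kBound m := by
  refine (inv_prod_le_exp_sum hm S hS).trans ?_
  have h := sum_primeFactors_inv_le' hm
  have hm1 : (1 : ℝ) ≤ m := by exact_mod_cast Nat.pos_of_ne_zero hm
  have hpos : 0 < Real.log m + 2 := by linarith [Real.log_nonneg hm1]
  have hpos' : 0 < Real.log (Real.log m + 2) := Real.log_pos (by linarith [Real.log_nonneg hm1])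
  unfold kBound
  calc Real.exp (6 * ∑ p ∈ m.primeFactors, (1 : ℝ) / p)
      ≤ Real.exp (6 * (Real.log (Real.log (Real.log m + 2)) + 6)) := by
        rw [Real.exp_le_exp]; linarith
    _ = Real.exp 36 * Real.log (Real.log m + 2) ^ 6 := by
        rw [show 6 * (Real.log (Real.log (Real.log ↑m + 2)) + 6) =
          (36 : ℝ) + ((6 : ℕ) : ℝ) * Real.log (Real.log (Real.log ↑m + 2)) by push_cast; ring,
          Real.exp_add, Real.exp_nat_mul, Real.exp_log hpos']

/-! ### Additive energy: `#{p₁ + p₃ = p₂ + p₄} = ∑_m r(m)²`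

The additive quadruples are `Literature.Tao2016.addQuadruples 𝒫 =
{((p₁,p₂),(p₃,p₄)) ∈ 𝒫⁴ : p₁ + p₃ = p₂ + p₄}` (`TaoCircleMethod.lean`). -/

/-- `r_𝒫(0) = 0` when `0 ∉ 𝒫`. [folklore] -/
theorem pairCount_zero {P : Finset ℕ} (h0 : 0 ∉ P) : pairCount P 0 = 0 := by
  rw [pairCount, Finset.card_eq_zero, Finset.filter_eq_empty_iff]
  intro q hq hsum
  rw [Finset.mem_product] at hq
  have : q.1 = 0 := by omega
  exact h0 (this ▸ hq.1)

/-- `∑_m r_𝒫(m) = #𝒫²` (every pair has some sum `m ≤ 2M`). [folklore] -/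
theorem sum_pairCount (P : Finset ℕ) {M : ℕ} (hP : ∀ p ∈ P, p ≤ M) :
    ∑ m ∈ range (2 * M + 1), pairCount P m = #P ^ 2 := by
  unfold pairCount
  rw [← Finset.card_eq_sum_card_fiberwise fun q hq => ?_, Finset.card_product, sq]
  simp only [Finset.mem_coe] at hq ⊢
  rw [Finset.mem_product] at hq
  rw [Finset.mem_range]
  have := hP _ hq.1
  have := hP _ hq.2
  omega

/-- **Additive energy as a sum of squares**: `#{p₁ + p₃ = p₂ + p₄} = ∑_m r_𝒫(m)²`. [folklore] -/
theorem card_addQuadruples_eq_sum_sq (P : Finset ℕ) {M : ℕ} (hP : ∀ p ∈ P, p ≤ M) :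
    #(LFunctions.Tao2016.addQuadruples P) = ∑ m ∈ range (2 * M + 1), pairCount P m ^ 2 := by
  -- reshuffle coordinates: `((a,b),(c,d)) ↦ ((a,c),(b,d))`
  set B := ((P ×ˢ P) ×ˢ (P ×ˢ P)).filter fun q : (ℕ × ℕ) × (ℕ × ℕ) =>
    q.1.1 + q.1.2 = q.2.1 + q.2.2 with hB
  have hAB : #(LFunctions.Tao2016.addQuadruples P) = #B := by
    refine Finset.card_nbij' (fun q => ((q.1.1, q.2.1), (q.1.2, q.2.2)))
      (fun q => ((q.1.1, q.2.1), (q.1.2, q.2.2))) ?_ ?_ (fun q _ => rfl) (fun q _ => rfl)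
    · intro q hq
      simp only [LFunctions.Tao2016.addQuadruples, Finset.coe_filter, Set.mem_setOf_eq, Finset.mem_product] at hq
      simp only [hB, Finset.coe_filter, Set.mem_setOf_eq, Finset.mem_product]
      exact ⟨⟨⟨hq.1.1.1, hq.1.2.1⟩, hq.1.1.2, hq.1.2.2⟩, hq.2⟩
    · intro q hq
      simp only [hB, Finset.coe_filter, Set.mem_setOf_eq, Finset.mem_product] at hq
      simp only [LFunctions.Tao2016.addQuadruples, Finset.coe_filter, Set.mem_setOf_eq, Finset.mem_product]
      exact ⟨⟨⟨hq.1.1.1, hq.1.2.1⟩, hq.1.1.2, hq.1.2.2⟩, hq.2⟩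
  rw [hAB]
  -- fibre over the common sum `m = a + c`
  rw [Finset.card_eq_sum_card_fiberwise (f := fun q : (ℕ × ℕ) × (ℕ × ℕ) => q.1.1 + q.1.2)
    (t := range (2 * M + 1)) fun q hq => ?_]
  · refine Finset.sum_congr rfl fun m _ => ?_
    have hfib : B.filter (fun q : (ℕ × ℕ) × (ℕ × ℕ) => q.1.1 + q.1.2 = m) =
        ((P ×ˢ P).filter fun q : ℕ × ℕ => q.1 + q.2 = m) ×ˢ
          ((P ×ˢ P).filter fun q : ℕ × ℕ => q.1 + q.2 = m) := by
      rw [hB, Finset.filter_filter, ← Finset.filter_product]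
      refine Finset.filter_congr fun q _ => ?_
      constructor
      · rintro ⟨h1, h2⟩; exact ⟨h2, by omega⟩
      · rintro ⟨h1, h2⟩; exact ⟨by omega, h1⟩
    rw [hfib, Finset.card_product, pairCount, sq]
  · simp only [Finset.mem_coe] at hq ⊢
    rw [Finset.mem_filter, Finset.mem_product, Finset.mem_product] at hq
    rw [Finset.mem_range]
    have := hP _ hq.1.1.1
    have := hP _ hq.1.1.2
    omega

/-- **From a uniform bound on `r_𝒫(m)` to the energy**: if `r_𝒫(m) ≤ R` for all `m`, then
`#{p₁ + p₃ = p₂ + p₄} ≤ R · #𝒫²`. [folklore] -/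
theorem card_addQuadruples_le_of_pairCount_le (P : Finset ℕ) {M : ℕ} (hP : ∀ p ∈ P, p ≤ M) {R : ℝ}
    (hR : ∀ m ∈ range (2 * M + 1), (pairCount P m : ℝ) ≤ R) :
    (#(LFunctions.Tao2016.addQuadruples P) : ℝ) ≤ R * #P ^ 2 := by
  rw [card_addQuadruples_eq_sum_sq P hP]
  push_cast
  calc ∑ m ∈ range (2 * M + 1), (pairCount P m : ℝ) ^ 2
      ≤ ∑ m ∈ range (2 * M + 1), R * (pairCount P m : ℝ) := by
        refine Finset.sum_le_sum fun m hm => ?_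
        rw [sq]
        exact mul_le_mul_of_nonneg_right (hR m hm) (Nat.cast_nonneg _)
    _ = R * #P ^ 2 := by
        rw [← Finset.mul_sum]
        congr 1
        exact_mod_cast sum_pairCount P hP

/-! ### The energy bound for primes in a dyadic interval -/

/-- **Explicit energy bound under the growth conditions.**  With `L = log N`, `ℓ = log L`, the
growth conditions of `BrunTwinPrimes.twin_count_le_of_conditions`, `z = ⌈exp(L/(84ℓ))⌉`, and a
set `𝒫` of primes in `[z, N]`:
`#{(p₁,p₂,p₃,p₄) ∈ 𝒫⁴ : p₁ + p₃ = p₂ + p₄} ≤ 28227 · K(2N) · N ℓ²/L² · #𝒫²`, where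
`K(x) = e^{36} (log (log x + 2))⁶` (`kBound`). [cite: CojocaruMurty2005, Theorem 5.4.4 (proof)] -/
theorem card_addQuadruples_le_of_conditions (N : ℕ) (P : Finset ℕ) {L ℓ : ℝ} (hL : L = Real.log N)
    (hℓ : ℓ = Real.log L) (h1 : 1 ≤ ℓ) (hR : Real.exp (59 * ℓ + L / 2) ≤ N / L ^ 2)
    (hz1 : Real.exp (L / (84 * ℓ)) + 1 ≤ N / L ^ 2) (hz3 : 3 ≤ Real.exp (L / (84 * ℓ)))
    (hP : ∀ p ∈ P, p.Prime ∧ ⌈Real.exp (L / (84 * ℓ))⌉₊ ≤ p ∧ p ≤ N) :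
    (#(LFunctions.Tao2016.addQuadruples P) : ℝ) ≤ 28227 * kBound (2 * N) * N * ℓ ^ 2 / L ^ 2 * #P ^ 2 := by
  have hN1 : 1 ≤ N := by
    -- `N / L² ≥ exp(…) + 1 > 0` forces `N ≥ 1`
    by_contra h0
    push Not at h0
    have : N = 0 := by omega
    subst this
    simp at hz1
    linarith [Real.exp_pos (L / (84 * ℓ))]
  have hN1R : (1 : ℝ) ≤ N := by exact_mod_cast hN1
  have h2N1 : (1 : ℝ) ≤ 2 * N := by linarith
  have hK1 : 1 ≤ kBound (2 * N) := one_le_kBound h2N1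
  refine card_addQuadruples_le_of_pairCount_le P (fun p hp => (hP p hp).2.2) fun m hm => ?_
  rcases Nat.eq_zero_or_pos m with rfl | hmpos
  · -- `m = 0`: no pairs
    have h0 : 0 ∉ P := fun h => Nat.not_prime_zero (hP 0 h).1
    rw [pairCount_zero h0, Nat.cast_zero]
    have : 0 ≤ (N : ℝ) * ℓ ^ 2 / L ^ 2 := by positivity
    have : 0 ≤ kBound (2 * N) := by linarith
    positivity
  · have hm2N : m ≤ 2 * N := by have := Finset.mem_range.mp hm; omega
    have hmR : (1 : ℝ) ≤ m := by exact_mod_cast hmpos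
    have hm2NR : (m : ℝ) ≤ 2 * N := by exact_mod_cast hm2N
    have hKm : ∀ S : Finset ℕ, (∀ p ∈ S, p.Prime ∧ p ≠ 2 ∧ p ∣ m) →
        (∏ p ∈ S, (1 - 2 / (p : ℝ)))⁻¹ ≤ kBound (2 * N) := fun S hS =>
      (inv_prod_le_kBound hmpos.ne' S hS).trans (by exact_mod_cast kBound_mono hmR hm2NR)
    have hsift := sifted_le_of_conditions N m hL hℓ h1 hR hz1 hz3 hK1 hKm
    have hpair : (pairCount P m : ℝ) ≤
        #{n ∈ Icc 1 N | ∀ p ∈ sievingSet m ⌈Real.exp (L / (84 * ℓ))⌉₊,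
          ¬p ∣ n * (n + shift m p)} := by
      exact_mod_cast pairCount_le_card_sifted P hP m
    have hz0 : (0 : ℝ) ≤ ⌈Real.exp (L / (84 * ℓ))⌉₊ := Nat.cast_nonneg _
    linarith

/-- **Additive energy of the primes in a dyadic interval** (the "standard upper bound sieve"
input of Tao 2016, Lemma 3.7, footnote; here via Brun's pure sieve, losing powers of
`log log N`): for all large `N` and every set `𝒫` of primes in `[N/2, N]`,
`#{(p₁,p₂,p₃,p₄) ∈ 𝒫⁴ : p₁ + p₃ = p₂ + p₄} ≤ 28227 · K(2N) · N (log log N)²/(log N)² · #𝒫²`,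
`K(x) = e^{36} (log (log x + 2))⁶`.  With `#𝒫 ≪ N / log N` (Chebyshev) this is
`≪ N³ (log log N)^{8} / (log N)⁴`. [cite: TaoFMP2016, Lemma 3.7 (footnote)] -/
theorem eventually_card_addQuadruples_le :
    ∀ᶠ N : ℕ in Filter.atTop, ∀ P : Finset ℕ,
      (∀ p ∈ P, p.Prime ∧ (N : ℝ) ≤ 2 * p ∧ p ≤ N) →
        (#(LFunctions.Tao2016.addQuadruples P) : ℝ) ≤ 28227 * kBound (2 * N) * N * Real.log (Real.log N) ^ 2 /
          Real.log N ^ 2 * #P ^ 2 := by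
  filter_upwards [tendsto_natCast_atTop_atTop.eventually BrunTwinPrimes.eventually_conditions]
    with N hN
  intro P hP
  obtain ⟨h1, hR, hz1, hz3⟩ := hN
  set L := Real.log (N : ℝ) with hL
  set ℓ := Real.log L with hℓ
  refine card_addQuadruples_le_of_conditions N P hL hℓ h1 hR hz1 hz3 fun p hp => ?_
  obtain ⟨hpp, hNp, hpN⟩ := hP p hp
  refine ⟨hpp, ?_, hpN⟩
  -- `z ≤ exp(…) + 1 ≤ N / L² ≤ N / 4 < N / 2 ≤ p`
  have hLgt : 2 < L := by
    have hL1 : Real.exp 1 ≤ L := by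
      have hLpos : 0 < L := by
        by_contra h0
        push Not at h0
        have : ℓ ≤ 0 := by
          rw [hℓ]
          rcases h0.lt_or_eq with hlt | heq
          · have : L = 0 := le_antisymm h0 (Real.log_natCast_nonneg N); rw [this, Real.log_zero]
          · rw [heq, Real.log_zero]
        linarith
      have := Real.exp_le_exp.mpr (hℓ ▸ h1 : 1 ≤ Real.log L)
      rwa [Real.exp_log hLpos] at this
    exact lt_of_lt_of_le (by have := Real.exp_one_gt_d9; linarith) hL1
  have hN0 : (0 : ℝ) ≤ N := Nat.cast_nonneg N
  have hzR : (⌈Real.exp (L / (84 * ℓ))⌉₊ : ℝ) ≤ p := by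
    have hc : (⌈Real.exp (L / (84 * ℓ))⌉₊ : ℝ) < Real.exp (L / (84 * ℓ)) + 1 :=
      Nat.ceil_lt_add_one (Real.exp_pos _).le
    have hNL : (N : ℝ) / L ^ 2 ≤ N / 4 :=
      div_le_div_of_nonneg_left hN0 (by norm_num) (by nlinarith)
    linarith
  exact_mod_cast hzR

/-- The same with an absolute constant and a clean power of `log log N`: there is `C` such that
for all large `N` and every set `𝒫` of primes in `[N/2, N]`,
`#{p₁ + p₃ = p₂ + p₄ in 𝒫} ≤ C N (log log N)⁸/(log N)² · #𝒫²`.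
[cite: TaoFMP2016, Lemma 3.7 (footnote)] -/
theorem exists_eventually_card_addQuadruples_le :
    ∃ C : ℝ, 0 < C ∧ ∀ᶠ N : ℕ in Filter.atTop, ∀ P : Finset ℕ,
      (∀ p ∈ P, p.Prime ∧ (N : ℝ) ≤ 2 * p ∧ p ≤ N) →
        (#(LFunctions.Tao2016.addQuadruples P) : ℝ) ≤ C * N * Real.log (Real.log N) ^ 8 / Real.log N ^ 2 * #P ^ 2 := by
  refine ⟨28227 * (Real.exp 36 * 2 ^ 6), by positivity, ?_⟩
  have hev : ∀ᶠ N : ℕ in Filter.atTop, (3 : ℝ) ≤ Real.log N :=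
    (Real.tendsto_log_atTop.comp tendsto_natCast_atTop_atTop).eventually_ge_atTop 3
  filter_upwards [eventually_card_addQuadruples_le, hev] with N hN h3 P hP
  refine (hN P hP).trans ?_
  set L := Real.log (N : ℝ) with hL
  have hN0 : (0 : ℝ) < N := by
    have : (0 : ℝ) < Real.log N := by linarith
    by_contra h
    push Not at h
    have : Real.log (N : ℝ) ≤ 0 := by
      rcases h.lt_or_eq with hlt | heq
      · linarith [Nat.cast_nonneg (α := ℝ) N]
      · rw [heq, Real.log_zero]
    linarith
  -- `kBound (2N) ≤ e^{36} 2^6 (log log N)^6` since `log (2N) + 2 ≤ L²`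
  have hlogL : 1 ≤ Real.log L := by
    rw [← Real.log_exp 1]
    exact Real.log_le_log (Real.exp_pos 1) (by have := Real.exp_one_lt_d9; linarith)
  have hk : kBound (2 * N) ≤ Real.exp 36 * 2 ^ 6 * Real.log L ^ 6 := by
    unfold kBound
    rw [mul_assoc]
    refine mul_le_mul_of_nonneg_left ?_ (Real.exp_pos _).le
    have h2N : Real.log (2 * N) + 2 ≤ L ^ 2 := by
      rw [Real.log_mul (by norm_num) hN0.ne', ← hL]
      have := Real.log_two_lt_d9
      nlinarith
    have hpos : 0 < Real.log (2 * N) + 2 := by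
      have : 0 ≤ Real.log (2 * (N : ℝ)) := Real.log_nonneg (by
        have : (1 : ℝ) ≤ N := by
          by_contra h; push Not at h
          have : Real.log (N : ℝ) ≤ 0 := Real.log_nonpos hN0.le h.le
          linarith
        linarith)
      linarith
    have hle : Real.log (Real.log (2 * N) + 2) ≤ 2 * Real.log L := by
      calc Real.log (Real.log (2 * N) + 2) ≤ Real.log (L ^ 2) := Real.log_le_log hpos h2N
        _ = 2 * Real.log L := by rw [Real.log_pow]; norm_num
    have h0 : 0 ≤ Real.log (Real.log (2 * N) + 2) := Real.log_nonneg (by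
      have : 0 ≤ Real.log (2 * (N : ℝ)) := by
        have := Real.log_le_log hN0 (by linarith : (N : ℝ) ≤ 2 * N); linarith
      linarith)
    calc Real.log (Real.log (2 * N) + 2) ^ 6 ≤ (2 * Real.log L) ^ 6 := pow_le_pow_left₀ h0 hle 6
      _ = 2 ^ 6 * Real.log L ^ 6 := by ring
  have hrest : 0 ≤ (N : ℝ) * Real.log L ^ 2 / L ^ 2 * #P ^ 2 := by positivity
  calc 28227 * kBound (2 * N) * N * Real.log L ^ 2 / L ^ 2 * #P ^ 2
      = kBound (2 * N) * (28227 * (N * Real.log L ^ 2 / L ^ 2 * #P ^ 2)) := by ring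
    _ ≤ (Real.exp 36 * 2 ^ 6 * Real.log L ^ 6) * (28227 * (N * Real.log L ^ 2 / L ^ 2 * #P ^ 2)) :=
        mul_le_mul_of_nonneg_right hk (by positivity)
    _ = 28227 * (Real.exp 36 * 2 ^ 6) * N * Real.log L ^ 8 / L ^ 2 * #P ^ 2 := by ring

end ShiftedPrimePairs

end Literature.NumberTheory.Sieve
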